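import Summits.RiemannHypothesis.RiemannHypothesis.Theorems.PfPersistenceM2OddSectorEngine
import Summits.RiemannHypothesis.RiemannHypothesis.Theorems.PfPersistenceM2EvenSectorUnconditional
import Summits.RiemannHypothesis.RiemannHypothesis.Theorems.PfPersistenceM2RealSectorEncard
import HarnessLib

/-!
# Pf-persistence index route (M2), odd sector at `K = ∞`, part 3/3: the complete two-parity ladder

Long-odds MECHANISM SEARCH (cell `pub-rhpf`, seat M2); every result here is RH-free and makes no
claim about RH.  Notation: `𝒬 = {ρ : ζ(ρ) = 0 non-trivial, Re ρ > 1/2, Im ρ > 0}` (one representative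
per off-line quadruple), `K = #𝒬 ∈ ℕ ∪ {∞}` (`Set.encard`), `𝒵_θ = {ρ ∈ 𝒬-closure : Re ρ ≥ 1/2 + θ}`,
`EvenNegIndexAtLeast n a` / `OddNegIndexAtLeast n a` / `RealNegIndexAtLeast n a` = the window
`[-a, a]` carries `n` even / odd / arbitrary real compactly supported Weil tests on whose real span
`Re Q` is negative definite (`Q = weilQuadratic`).

STATE BEFORE THIS FILE.  Even ladder: `(∃ a, EvenNegIndexAtLeast n a) ⟺ n ≤ K` for every
`K ∈ ℕ ∪ {∞}` (unconditional, `exists_evenNegIndexAtLeast_iff_encard`).  Real ladder: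
`(∃ a, RealNegIndexAtLeast n a) ⟺ n ≤ 2K` for every `K` (`exists_realNegIndexAtLeast_iff_encard`).
Odd ladder: `⟺ n ≤ K` for FINITE `K` only (cand-7 seat, `exists_oddNegIndexAtLeast_iff hfin`), the
upper half `n ≤ K` for every `K` (`le_encard_quadrant_of_oddNegIndexAtLeast`).

PROVED here (RH-free, UNCONDITIONAL — the annihilation input is the theorem `quadrantAnnihilable_pos`,
resting on the in-tree Ingham zero-density theorem):
* `exists_oddNegIndexAtLeast_iff_encard` — `(∃ a, OddNegIndexAtLeast n a) ⟺ n ≤ K` for EVERY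
  `K ∈ ℕ ∪ {∞}`; `forall_not_oddNegIndexAtLeast_succ_iff_encard` — odd level `n + 1` clean on all
  windows `⟺ K ≤ n`.
* `exists_oddNegIndexAtLeast_iff_exists_evenNegIndexAtLeast`,
  `forall_not_oddNegIndexAtLeast_succ_iff_forall_not_even` — PARITY SYMMETRY of the index ladder:
  at every level the even and the odd sector agree (both read off `K`).
* `twoParity_index_ladder_encard`, `twoParity_level_ladder_encard` — the three ladders side by side;
  `exists_even_and_odd_negIndexAtLeast_of_le_encard` — one window carrying `n` even AND `n` odd
  negative directions whenever `n ≤ K`.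
Level `0` of each ladder (`K = 0 ⟺ RH`) is of course untouched: these are counting identities for the
negative index of the Weil form, not evidence for or against RH.
-/

noncomputable section

open Complex Filter Set MeasureTheory
open scoped Real Topology ComplexConjugate BigOperators

namespace Summit.RiemannHypothesis.RiemannHypothesis.Theorems.PfPersistenceM2NegIndex

open Literature.NumberTheory.LFunctions
open Literature.NumberTheory.LFunctions.ZetaZeros
open Summit.RiemannHypothesis.RiemannHypothesis.Theorems.PfPersistenceParityIndex
  (OddNegIndexAtLeast le_encard_quadrant_of_oddNegIndexAtLeast not_oddNegIndexAtLeast_succ_of_encard_le)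

/-! ## A. `n ≤ K` quadruples sit at a common positive distance from the line -/

/-- If `n ≤ K = #𝒬` (in `ℕ∞`), then some `θ > 0` already has `n ≤ #𝒵_θ`: `n` of the quadruples lie at
real-part distance `≥ θ` from the critical line (take `θ = min Re - 1/2` over `n` of them). [folklore] -/
theorem exists_pos_le_encard_above_of_le_encard_quadrant {n : ℕ}
    (hle : (n : ℕ∞) ≤ {ρ : ℂ | ρ ∈ riemannZetaNontrivialZeros ∧ 1 / 2 < ρ.re ∧ 0 < ρ.im}.encard) :
    ∃ θ : ℝ, 0 < θ ∧
      (n : ℕ∞) ≤ {ρ : ℂ | ρ ∈ riemannZetaNontrivialZeros ∧ 1 / 2 + θ ≤ ρ.re ∧ 0 < ρ.im}.encard := by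
  classical
  cases n with
  | zero => exact ⟨1, one_pos, by simp⟩
  | succ k =>
    obtain ⟨F, hFsub, hFcard⟩ := exists_subset_encard_eq hle
    have hFfin : F.Finite := finite_of_encard_eq_coe hFcard
    have hFne : F.Nonempty := encard_pos.1 (by rw [hFcard]; exact_mod_cast Nat.succ_pos k)
    obtain ⟨ρ₀, hρ₀, hmin⟩ :=
      hFfin.toFinset.exists_min_image (fun ρ : ℂ ↦ ρ.re) ((Finite.toFinset_nonempty hFfin).2 hFne)
    have hρ₀F : ρ₀ ∈ F := hFfin.mem_toFinset.1 hρ₀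
    refine ⟨ρ₀.re - 1 / 2, by linarith [(hFsub hρ₀F).2.1], ?_⟩
    have hsub : F ⊆ {ρ : ℂ | ρ ∈ riemannZetaNontrivialZeros ∧ 1 / 2 + (ρ₀.re - 1 / 2) ≤ ρ.re ∧
        0 < ρ.im} := fun ρ hρ ↦
      ⟨(hFsub hρ).1, by linarith [hmin ρ (hFfin.mem_toFinset.2 hρ)], (hFsub hρ).2.2⟩
    rw [← hFcard]
    exact encard_le_encard hsub

/-! ## B. The odd ladder for every `K ∈ ℕ ∪ {∞}` -/

/-- Odd negative index `≥ n` on all long windows from `n ≤ #𝒵_θ`, modulo (QA_θ) (the odd engine of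
part 2 plus window monotonicity). [cite: Bombieri2000Weil, Thm 9 (odd part)] -/
theorem oddNegIndexAtLeast_of_annihilable {θ : ℝ} (hθ : 0 < θ) (hann : QuadrantAnnihilable θ) {n : ℕ}
    (hn : (n : ℕ∞) ≤ {ρ : ℂ | ρ ∈ riemannZetaNontrivialZeros ∧ 1 / 2 + θ ≤ ρ.re ∧ 0 < ρ.im}.encard) :
    ∃ A : ℝ, ∀ a : ℝ, A ≤ a → OddNegIndexAtLeast n a := by
  obtain ⟨A, g, h1, h2, h3, h4, h5⟩ := exists_negative_definite_odd_family_of_annihilable hθ hann hn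
  exact ⟨A, fun a ha ↦ PfPersistenceParityIndex.OddNegIndexAtLeast.mono ⟨g, h1, h2, h3, h4, h5⟩ ha⟩

/-- **THE ODD LADDER, every `K ∈ ℕ ∪ {∞}` (RH-free, unconditional).**  For every `n`:
`(∃ a, OddNegIndexAtLeast n a) ⟺ n ≤ K = #𝒬`.  (`→`) is the cand-7 seat's upper half; (`←`): `n` of the
quadruples lie at distance `≥ θ > 0` (§A), (QA_θ) holds unconditionally (`quadrantAnnihilable_pos`), and
the odd engine fires.  The finite-`K` case is cand-7's `exists_oddNegIndexAtLeast_iff`.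
[cite: Bombieri2000Weil, Thm 9 (odd part); Thm 11] -/
theorem exists_oddNegIndexAtLeast_iff_encard (n : ℕ) :
    (∃ a : ℝ, OddNegIndexAtLeast n a) ↔
      (n : ℕ∞) ≤ {ρ : ℂ | ρ ∈ riemannZetaNontrivialZeros ∧ 1 / 2 < ρ.re ∧ 0 < ρ.im}.encard := by
  constructor
  · rintro ⟨a, ha⟩
    exact le_encard_quadrant_of_oddNegIndexAtLeast ha
  · intro hn
    obtain ⟨θ, hθ, hθn⟩ := exists_pos_le_encard_above_of_le_encard_quadrant hn
    obtain ⟨A, hA⟩ := oddNegIndexAtLeast_of_annihilable hθ (quadrantAnnihilable_pos hθ) hθn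
    exact ⟨A, hA A le_rfl⟩

/-- **Odd levels, every `K`.**  Odd level `n + 1` is clean on every window iff `K ≤ n`.
[cite: Bombieri2000Weil, Thm 9 (odd part)] -/
theorem forall_not_oddNegIndexAtLeast_succ_iff_encard (n : ℕ) :
    (∀ a : ℝ, ¬ OddNegIndexAtLeast (n + 1) a) ↔
      {ρ : ℂ | ρ ∈ riemannZetaNontrivialZeros ∧ 1 / 2 < ρ.re ∧ 0 < ρ.im}.encard ≤ n := by
  rw [← not_lt, ← not_exists, not_iff_not, exists_oddNegIndexAtLeast_iff_encard]
  constructor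
  · intro h
    exact lt_of_lt_of_le (by exact_mod_cast Nat.lt_succ_self n) h
  · intro h
    have h1 := Order.add_one_le_of_lt h
    exact_mod_cast h1

/-! ## C. Parity symmetry and the three ladders side by side -/

/-- **Parity symmetry of the index ladder (RH-free, unconditional).**  A window with `n` independent
negative ODD directions exists iff one with `n` independent negative EVEN directions does (both iff
`n ≤ K`). [folklore] -/
theorem exists_oddNegIndexAtLeast_iff_exists_evenNegIndexAtLeast (n : ℕ) :
    (∃ a : ℝ, OddNegIndexAtLeast n a) ↔ ∃ a : ℝ, EvenNegIndexAtLeast n a := by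
  rw [exists_oddNegIndexAtLeast_iff_encard, exists_evenNegIndexAtLeast_iff_encard]

/-- Level form of the parity symmetry: odd level `n + 1` is clean on all windows iff even level `n + 1`
is. [folklore] -/
theorem forall_not_oddNegIndexAtLeast_succ_iff_forall_not_even (n : ℕ) :
    (∀ a : ℝ, ¬ OddNegIndexAtLeast (n + 1) a) ↔ ∀ a : ℝ, ¬ EvenNegIndexAtLeast (n + 1) a := by
  rw [forall_not_oddNegIndexAtLeast_succ_iff_encard, forall_not_evenNegIndexAtLeast_succ_iff_encard]

/-- **THE TWO-PARITY INDEX LADDER (RH-free, unconditional, every `K ∈ ℕ ∪ {∞}`).**  For every `n`: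
even index `≥ n` on some window `⟺ n ≤ K`; odd index `≥ n` on some window `⟺ n ≤ K`; real index `≥ n`
on some window `⟺ n ≤ 2K`. [cite: Bombieri2000Weil, Thms 8, 9, 11] -/
theorem twoParity_index_ladder_encard (n : ℕ) :
    ((∃ a : ℝ, EvenNegIndexAtLeast n a) ↔
        (n : ℕ∞) ≤ {ρ : ℂ | ρ ∈ riemannZetaNontrivialZeros ∧ 1 / 2 < ρ.re ∧ 0 < ρ.im}.encard) ∧
      ((∃ a : ℝ, OddNegIndexAtLeast n a) ↔
        (n : ℕ∞) ≤ {ρ : ℂ | ρ ∈ riemannZetaNontrivialZeros ∧ 1 / 2 < ρ.re ∧ 0 < ρ.im}.encard) ∧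
      ((∃ a : ℝ, RealNegIndexAtLeast n a) ↔
        (n : ℕ∞) ≤ 2 * {ρ : ℂ | ρ ∈ riemannZetaNontrivialZeros ∧ 1 / 2 < ρ.re ∧ 0 < ρ.im}.encard) :=
  ⟨exists_evenNegIndexAtLeast_iff_encard n, exists_oddNegIndexAtLeast_iff_encard n,
    exists_realNegIndexAtLeast_iff_encard n⟩

/-- **Level form.**  For every `n`: even level `n + 1` clean `⟺ K ≤ n`; odd level `n + 1` clean
`⟺ K ≤ n`; real level `n + 1` clean `⟺ 2K ≤ n` — on every `K ∈ ℕ ∪ {∞}`.  (Level `0`, i.e. `n + 1 = 1`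
with `K = 0`, is RH itself and is not addressed.) [cite: Bombieri2000Weil, Thms 8, 9, 11] -/
theorem twoParity_level_ladder_encard (n : ℕ) :
    ((∀ a : ℝ, ¬ EvenNegIndexAtLeast (n + 1) a) ↔
        {ρ : ℂ | ρ ∈ riemannZetaNontrivialZeros ∧ 1 / 2 < ρ.re ∧ 0 < ρ.im}.encard ≤ n) ∧
      ((∀ a : ℝ, ¬ OddNegIndexAtLeast (n + 1) a) ↔
        {ρ : ℂ | ρ ∈ riemannZetaNontrivialZeros ∧ 1 / 2 < ρ.re ∧ 0 < ρ.im}.encard ≤ n) ∧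
      ((∀ a : ℝ, ¬ RealNegIndexAtLeast (n + 1) a) ↔
        2 * {ρ : ℂ | ρ ∈ riemannZetaNontrivialZeros ∧ 1 / 2 < ρ.re ∧ 0 < ρ.im}.encard ≤ n) :=
  ⟨forall_not_evenNegIndexAtLeast_succ_iff_encard n, forall_not_oddNegIndexAtLeast_succ_iff_encard n,
    forall_not_realNegIndexAtLeast_succ_iff_encard n⟩

/-- One window carrying `n` even AND `n` odd independent negative directions, whenever `n ≤ K`
(`K = ∞`: every `n`). [folklore] -/
theorem exists_even_and_odd_negIndexAtLeast_of_le_encard {n : ℕ}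
    (hn : (n : ℕ∞) ≤ {ρ : ℂ | ρ ∈ riemannZetaNontrivialZeros ∧ 1 / 2 < ρ.re ∧ 0 < ρ.im}.encard) :
    ∃ a : ℝ, EvenNegIndexAtLeast n a ∧ OddNegIndexAtLeast n a := by
  obtain ⟨a₁, h₁⟩ := (exists_evenNegIndexAtLeast_iff_encard n).2 hn
  obtain ⟨a₂, h₂⟩ := (exists_oddNegIndexAtLeast_iff_encard n).2 hn
  exact ⟨max a₁ a₂, h₁.mono (le_max_left _ _),
    PfPersistenceParityIndex.OddNegIndexAtLeast.mono h₂ (le_max_right _ _)⟩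

/-- `K = ∞` spelled out: if there are infinitely many off-line quadruples then EVERY level of all three
ladders is dirty on long windows — for every `n` one window carries `n` even, `n` odd and (hence) `2n`
real independent negative directions. [cite: Bombieri2000Weil, Thm 11] -/
theorem forall_exists_negIndexAtLeast_of_quadrant_infinite
    (hinf : {ρ : ℂ | ρ ∈ riemannZetaNontrivialZeros ∧ 1 / 2 < ρ.re ∧ 0 < ρ.im}.Infinite) (n : ℕ) :
    ∃ a : ℝ, EvenNegIndexAtLeast n a ∧ OddNegIndexAtLeast n a ∧ RealNegIndexAtLeast (2 * n) a := by
  have hn : (n : ℕ∞) ≤ {ρ : ℂ | ρ ∈ riemannZetaNontrivialZeros ∧ 1 / 2 < ρ.re ∧ 0 < ρ.im}.encard := by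
    rw [hinf.encard_eq]; exact le_top
  have h2n : ((2 * n : ℕ) : ℕ∞) ≤
      2 * {ρ : ℂ | ρ ∈ riemannZetaNontrivialZeros ∧ 1 / 2 < ρ.re ∧ 0 < ρ.im}.encard := by
    rw [hinf.encard_eq]; exact le_top
  obtain ⟨a, he, ho⟩ := exists_even_and_odd_negIndexAtLeast_of_le_encard hn
  obtain ⟨a', hr⟩ := (exists_realNegIndexAtLeast_iff_encard (2 * n)).2 h2n
  exact ⟨max a a', he.mono (le_max_left _ _),
    PfPersistenceParityIndex.OddNegIndexAtLeast.mono ho (le_max_left _ _), hr.mono (le_max_right _ _)⟩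

end Summit.RiemannHypothesis.RiemannHypothesis.Theorems.PfPersistenceM2NegIndex

end
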